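import Summits.BirchSwinnertonDyer.BirchSwinnertonDyer.Theorems.PrintCFramBottomClassIndexLawFiveLeBorelKolyvaginVisibility
import Literature.NumberTheory.GaloisRepresentations.AbsGaloisOuterConj
import HarnessLib

/-!
# Route `PrintCFram`, crux C2 `BottomClassIndexLawFiveLe` (stmt-BirchSwinnertonDyer-20372), line
# `eisenstein-resource-bdp-line` (stub `stub_kolyvaginUpper_borelCM_pairSum_offKrizLi`, input (γ)):
# **THE FROBENIUS OF AN ARBITRARY KOLYVAGIN PRIME IS `∼ g^τ g`**, and invisible classes die at EVERY
# Kolyvagin prime (the descent's `A ℓ`)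
# (cell `bsd-print-cfram`, seat `bsd-line-cfram-p1-w2` g6; helper `--supports` 20372; 0 facts, 0 defs)

HONEST FRAMING. Nothing about BSD is proved here, and nothing of the stub itself. The tree's
Čebotarev theorems (`exists_kolyvaginPrime_gt*`) CONSTRUCT Kolyvagin primes and read the local
condition at `λ` off the Frobenius `g^τ g` they built; the descent (`KolyvaginDescent.HypothesesM`)
quantifies over ALL Kolyvagin primes through the predicate `IsKolyvaginPrime N W K p ℓ ∧
FrobEqFrobInfty W K (p^M) ℓ`. This file supplies the missing converse reading: for ANY prime `ℓ`
unramified in the imaginary quadratic `K` with `Frob(ℓ) = Frob(∞)` on `K(E[n])` (Gross (3.2),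
`FrobEqFrobInfty`), at the place `λ ∋ ℓ` of `K` there are a local prime `𝔐`, an arithmetic
Frobenius `F` at the prime below it, and `g ∈ Γ_{K(E[n])}` with **`F = δ (g^τ g) δ⁻¹`**, `τ` the
lift of complex conjugation along the complex conjugation `c₀` of the witness
(`exists_frobenius_conjGalCMH_mul_of_frobEqFrobInfty`; Step F–G of the tree's proof, run on the
witness instead of on the Čebotarev element). Ingredients: `¬ ℓ ∣ d_K ⟹` the place of `ℚ` at `ℓ`
is unramified in `𝓞 K` (`isUnramifiedIn_of_not_dvd_discr`, Dedekind via Mathlib's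
`NumberField.not_dvd_discr_iff_isUnramifiedIn` and the tower `ℤ ⊂ 𝓞 ℚ ⊂ 𝓞 K`); the witness `h`
is `c₀ · res g` with `g` fixing `E[n]` (`exists_eq_mul_absGaloisRestrict_of_frobEqFrobInfty`).
Consequence for the Borel CM class (with `…BorelKolyvaginVisibility`): the sign `η_line` does not
depend on the complex conjugation (`lineSign_of_isComplexConjugation_of_lineSign`), so a
`c_*`-eigenclass whose values lie on `W[𝔭]` with `η_line = −ν` is locally trivial at the place of
EVERY Kolyvagin prime of level `p^M` where it is unramified and `W` has good reduction
(`mem_torsionLocalKer_place_of_line_of_lineSign`) — i.e. it lies in every `A ℓ` of the descent: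
no axiom `cebotarev` prescribing it a non-zero local order can hold. THEOREMS ONLY; no definition,
no named fact, no `sorry`. BSD is not proved by any of this; no summit statement is proved by this
seat. References: [GrossLMS1991] §3 (3.1)–(3.2), Prop. 9.6; [McCallumLMS1991] §3 (3).
-/

set_option autoImplicit false
-- `…BirchSwinnertonDyer.BirchSwinnertonDyer.Theorems…` is the problem's mandated namespace (D-0017).
set_option linter.dupNamespace false

noncomputable section

open scoped Classical

namespace Summit.BirchSwinnertonDyer.BirchSwinnertonDyer.Theorems.PrintCFram.BorelKolyvaginPairing

open WeierstrassCurve NumberField IsDedekindDomain Field Literature.NumberTheory.EllipticCurves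
  Literature.NumberTheory.GaloisRepresentations Literature.NumberTheory.EllipticCurves.Rank1Residual
  Summit.BirchSwinnertonDyer.BirchSwinnertonDyer.Theorems.PrintCFram.BorelHomothety

universe u

/-! ## §1 `ℓ ∤ d_K`: the place of `ℚ` at `ℓ` is unramified in `K` -/

section Unramified

variable {K : Type u} [Field K] [NumberField K]

/-- **`ℓ ∤ d_K` ⟹ the place `(ℓ)` of `ℚ` is unramified in `𝓞 K`** (Dedekind's discriminant
theorem, Mathlib `NumberField.not_dvd_discr_iff_isUnramifiedIn`, moved from the base `ℤ` to the
base `𝓞 ℚ` along the tower `ℤ ⊂ 𝓞 ℚ ⊂ 𝓞 K`: `e(𝔓|ℤ) = e(𝔓 ∩ 𝓞 ℚ|ℤ)·e(𝔓|𝓞 ℚ)`). [folklore] -/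
theorem isUnramifiedIn_of_not_dvd_discr {ℓ : ℕ} (hℓ : ℓ.Prime)
    (hℓD : ¬ ((ℓ : ℤ) ∣ NumberField.discr K)) {v : HeightOneSpectrum (𝓞 ℚ)}
    (hℓv : (ℓ : 𝓞 ℚ) ∈ v.asIdeal) : Algebra.IsUnramifiedIn (𝓞 K) v.asIdeal := by
  have hZ : Algebra.IsUnramifiedIn (𝓞 K) (Ideal.span {(ℓ : ℤ)}) :=
    (NumberField.not_dvd_discr_iff_isUnramifiedIn K (𝓞 K) (Nat.prime_iff_prime_int.mp hℓ)).mp hℓD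
  rw [Algebra.isUnramifiedIn_iff_forall_of_isDedekindDomain] at hZ
  intro 𝔓 h𝔓 hover
  haveI := h𝔓
  haveI := hover
  have hne : 𝔓 ≠ ⊥ := Ideal.ne_bot_of_liesOver_of_ne_bot v.ne_bot 𝔓
  haveI h𝔓max : 𝔓.IsMaximal := h𝔓.isMaximal hne
  -- `𝔓` lies over `(ℓ) ⊂ ℤ`
  have hℓ𝔓 : (ℓ : 𝓞 K) ∈ 𝔓 := by
    have h1 : algebraMap (𝓞 ℚ) (𝓞 K) (ℓ : 𝓞 ℚ) ∈ 𝔓 := by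
      rw [← Ideal.mem_comap, ← Ideal.under_def, ← hover.over]; exact hℓv
    rwa [map_natCast] at h1
  have hunderZ : 𝔓.under ℤ = Ideal.span {(ℓ : ℤ)} := by
    have hmax : (Ideal.span {(ℓ : ℤ)}).IsMaximal :=
      PrincipalIdealRing.isMaximal_of_irreducible
        (Nat.prime_iff_prime_int.mp hℓ).irreducible
    refine (hmax.eq_of_le (Ideal.IsPrime.ne_top inferInstance) ?_).symm
    rw [Ideal.span_singleton_le_iff_mem, Ideal.under_def, Ideal.mem_comap, map_natCast]
    exact hℓ𝔓
  haveI : 𝔓.LiesOver (Ideal.span {(ℓ : ℤ)}) := ⟨hunderZ.symm⟩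
  haveI hZ𝔓 : Algebra.IsUnramifiedAt ℤ 𝔓 := hZ 𝔓 h𝔓max inferInstance
  haveI : (𝔓.under (𝓞 ℚ)).IsMaximal := by rw [← hover.over]; exact v.isMaximal
  -- the tower
  have e1 : 𝔓.ramificationIdx ℤ = 1 := Ideal.ramificationIdx_eq_one 𝔓 ℤ
  have e3 := Ideal.ramificationIdx_tower (R := ℤ) (𝔓.under (𝓞 ℚ)) 𝔓
  rw [e1] at e3
  exact Ideal.ramificationIdx_eq_one_iff.mp (Nat.eq_one_of_mul_eq_one_left e3.symm)

end Unramified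

/-! ## §2 The Frobenius at the place of a Kolyvagin prime is a conjugate of `g^τ g` -/

section Frobenius

variable (W : WeierstrassCurve ℚ) [W.IsElliptic] {K : Type} [Field K] [NumberField K]

omit [W.IsElliptic] in
/-- **The witness of `Frob(ℓ) = Frob(∞)` is `c₀ · res g` with `g ∈ Γ_{K(E[n])}`.** If `h ∈ Γ_ℚ`
acts on `E(ℚ̄)[n]` and on (every embedded copy of) `K` as the complex conjugation `c₀` does, then
`h = c₀ · res g` for some `g ∈ Γ_K` fixing `E(K̄)[n]` (`res(Γ_K) = ` the pointwise stabiliser of the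
embedded `K`, tree `mem_range_absGaloisRestrict_iff_smul_absEmbedding`). [cite: GrossLMS1991, §3 (3.2)] -/
theorem exists_eq_mul_absGaloisRestrict_of_smul_eq {n : ℤ} {h c₀ : absoluteGaloisGroup ℚ}
    (hP : ∀ P : geomTorsion W n, h • P = c₀ • P)
    (hK : ∀ (e : K →ₐ[ℚ] AlgebraicClosure ℚ) (x : K), h • e x = c₀ • e x) :
    ∃ g ∈ torsionFixing (W.baseChange K) n, h = c₀ * absGaloisRestrict ℚ K g := by
  have hmem : c₀⁻¹ * h ∈ (absGaloisRestrict ℚ K).range := by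
    rw [mem_range_absGaloisRestrict_iff_smul_absEmbedding]
    intro x
    have hx := hK (absEmbedding ℚ K) x
    calc (c₀⁻¹ * h) • absEmbedding ℚ K x = c₀⁻¹ • (h • absEmbedding ℚ K x) := mul_smul _ _ _
      _ = c₀⁻¹ • (c₀ • absEmbedding ℚ K x) := congrArg (c₀⁻¹ • ·) hx
      _ = absEmbedding ℚ K x := inv_smul_smul _ _
  obtain ⟨g, hg⟩ := hmem
  have hg' : absGaloisRestrict ℚ K g = c₀⁻¹ * h := hg
  refine ⟨g, (mem_torsionFixing_iff _ n).mpr fun Q ↦ ?_, by rw [hg', mul_inv_cancel_left]⟩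
  obtain ⟨P, rfl⟩ := (RatClosure.torsionEquiv (K := K) W n).surjective Q
  rw [← RatClosure.torsionEquiv_smul W n g P, hg', mul_smul, hP, inv_smul_smul]

omit [W.IsElliptic] in
/-- **The Frobenius of an arbitrary Kolyvagin prime is `∼ g^τ g`** (Gross (3.2) read at `λ`). Let
`K` be imaginary quadratic with complex conjugation `c`, `n ≠ 0`, `ℓ` a prime with `ℓ ∤ d_K` and
`Frob(ℓ) = Frob(∞)` in `Gal(K(E_n)/ℚ)` (`FrobEqFrobInfty W K n ℓ`, `n` a natural level), and `w`
the place of `K` containing `ℓ`. Then, for the complex conjugation `c₀` of the witness and the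
lift `τ = e c₀ e⁻¹` of `c`: there are a prime `𝔐` of `\bar 𝓞_w`, elements `F δ g ∈ Γ_K` with `F`
an arithmetic Frobenius at the prime of `\bar ℤ_K` below `𝔐`, `g ∈ Γ_{K(E[n])}` and
**`F = δ · (g^τ g) · δ⁻¹`** — exactly the Frobenius datum of the tree's local criterion
`mem_torsionLocalKer_iff_h1Eval_eq_zero`; moreover `w` is the only place above `ℓ`.
[cite: GrossLMS1991, §3 (3.2) and Prop. 9.6] [cite: McCallumLMS1991, §3 (3)] -/
theorem exists_frobenius_conjGalCMH_mul_of_frobEqFrobInfty (hK : IsImaginaryQuadratic K)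
    {c : K ≃ₐ[ℚ] K} (hc : c ≠ 1) {n ℓ : ℕ} (hℓ : ℓ.Prime)
    (hℓD : ¬ ((ℓ : ℤ) ∣ NumberField.discr K)) (hfrob : FrobEqFrobInfty W K n ℓ)
    {w : HeightOneSpectrum (𝓞 K)} (hw : (ℓ : 𝓞 K) ∈ w.asIdeal) :
    ∃ (c₀ : absoluteGaloisGroup ℚ) (_ : IsComplexConjugation (Rat.castHom ℝ) c₀)
      (ht : IsLiftOfAut c (absGaloisTransport (K := ℚ) (L := K) c₀).toRingEquiv)
      (𝔐 : Ideal (HeightOneSpectrum.localAbsIntegers w)) (_ : 𝔐 ∈ w.localPrimesAbove)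
      (F δ g : absoluteGaloisGroup K),
      IsArithFrobAt (𝓞 K) F (w.primeBelow (closureEmb (K := K) (w.adicCompletion K)) 𝔐) ∧
        g ∈ torsionFixing (W.baseChange K) (n : ℤ) ∧ F = δ * (ht.conjGalCMH g * g) * δ⁻¹ ∧
        ∀ w' : HeightOneSpectrum (𝓞 K), (ℓ : 𝓞 K) ∈ w'.asIdeal → w' = w := by
  classical
  haveI : Algebra.IsQuadraticExtension ℚ K := ⟨hK.1⟩
  haveI : IsTotallyComplex K := hK.2
  obtain ⟨v, 𝔓₀, h, c₀, hℓv, h𝔓₀, hh, hc₀, hP, hKx⟩ := hfrob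
  have ht : IsLiftOfAut c (absGaloisTransport (K := ℚ) (L := K) c₀).toRingEquiv :=
    RatClosure.isLiftOfAut_absGaloisTransport_of_isImaginaryQuadratic hK hc hc₀
  -- `h = c₀ · res g`, `g ∈ Γ_{K(E[n])}`
  obtain ⟨g, hgT, hhg⟩ := exists_eq_mul_absGaloisRestrict_of_smul_eq W (K := K) hP hKx
  -- Step F of the tree: `ℓ` is inert with Frobenius `τ' = g^τ g` over `K`
  have hunr : Algebra.IsUnramifiedIn (𝓞 K) v.asIdeal := isUnramifiedIn_of_not_dvd_discr hℓ hℓD hℓv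
  have hHi := index_range_absGaloisRestrict_eq_finrank ℚ K
  haveI hHn : ((absGaloisRestrict ℚ K).range).Normal :=
    Subgroup.normal_of_index_eq_two (hHi.trans hK.1)
  have hI := inertia_le_range_absGaloisRestrict_of_isUnramifiedIn (K := K) hunr h𝔓₀
  have hΦH : h ∉ (absGaloisRestrict ℚ K).range := by
    intro hmem
    apply hc₀.not_mem_range_absGaloisRestrict (L := K) IsTotallyComplex.isComplex
    change c₀ ∈ ((absGaloisRestrict ℚ K).range : Set (absoluteGaloisGroup ℚ))
    have h' : c₀ = h * (absGaloisRestrict ℚ K g)⁻¹ := by rw [hhg]; group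
    rw [SetLike.mem_coe, h']
    exact Subgroup.mul_mem _ hmem (Subgroup.inv_mem _ ⟨g, rfl⟩)
  obtain ⟨w₀, 𝔔, τ', hwv, hwuniq, -, h𝔔w, -, hτ', hresτ'⟩ :=
    exists_place_inert_of_not_mem_range (F := ℚ) (M := K) (hK.1 ▸ Nat.prime_two) hHn
      (hHi.trans rfl) hunr h𝔓₀ hI hh hΦH
  rw [hK.1, hhg, sq_eq_absGaloisRestrict_conjGal_mul hc₀ ht g] at hresτ'
  have hτ'eq : τ' = ht.conjGalCMH g * g := absGaloisRestrict_injective ℚ K hresτ'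
  -- `w₀ = w` is the only place above `ℓ`
  have hwuniq' : ∀ w' : HeightOneSpectrum (𝓞 K), (ℓ : 𝓞 K) ∈ w'.asIdeal → w' = w₀ := by
    intro w' hw'
    apply hwuniq
    apply HeightOneSpectrum.eq_of_natCast_mem_rat hℓ _ hℓv
    rw [HeightOneSpectrum.under_asIdeal, Ideal.under_def, Ideal.mem_comap, map_natCast]
    exact hw'
  have hww₀ : w = w₀ := hwuniq' w hw
  subst hww₀
  -- Step G: move `τ'` to the prime below a local prime `𝔐`
  obtain ⟨𝔐, h𝔐⟩ := w.localPrimesAbove_nonempty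
  have h𝔓w : w.primeBelow (closureEmb (K := K) (w.adicCompletion K)) 𝔐 ∈ w.primesAbove :=
    w.primeBelow_mem_primesAbove h𝔐
  obtain ⟨δ, -, hF⟩ :=
    HeightOneSpectrum.exists_isArithFrobAt_conj_of_mem_primesAbove_holds h𝔔w h𝔓w hτ'
  exact ⟨c₀, hc₀, ht, 𝔐, h𝔐, δ * τ' * δ⁻¹, δ, g, hF, hgT, by rw [hτ'eq], hwuniq'⟩

end Frobenius

/-! ## §3 `η_line` is intrinsic; invisible classes lie in `A ℓ` for EVERY Kolyvagin prime -/

section Invisible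

variable (W : WeierstrassCurve ℚ) [W.IsElliptic] (p : ℕ) [hp : Fact p.Prime]

omit [W.IsElliptic] hp in
/-- **`η_line` does not depend on the complex conjugation.** If one complex conjugation `c₀` acts on
the line `ker μ = W[𝔭]` by `η`, so does every other complex conjugation `c₀'` (they are conjugate in
`Γ_ℚ`, tree `IsComplexConjugation.isConj`; the line is `Γ_ℚ`-stable of prime order, so `Γ_ℚ` acts
on it through scalars, which commute with `η`). [folklore] -/
theorem lineSign_of_isComplexConjugation_of_lineSign {c₀ c₀' : absoluteGaloisGroup ℚ}
    (hc₀ : IsComplexConjugation (Rat.castHom ℝ) c₀) (hc₀' : IsComplexConjugation (Rat.castHom ℝ) c₀')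
    {s : AlgebraicClosure ℚ} {μ : AddMonoid.End W.geomPoints}
    (hs : s ^ 2 = ((-(p : ℤ) : ℤ) : AlgebraicClosure ℚ))
    (hcomm : ∀ g : absoluteGaloisGroup ℚ, g • s = s → ∀ P, μ (g • P) = g • μ P)
    (hanti : ∀ g : absoluteGaloisGroup ℚ, g • s = -s → ∀ P, μ (g • P) = -(g • μ P)) {η : ℤ}
    (hη : ∀ P : W.geomPoints, μ P = 0 → c₀ • P = η • P) (P : W.geomPoints) (hP : μ P = 0) :
    c₀' • P = η • P := by
  obtain ⟨a, ha⟩ := isConj_iff.mp (hc₀.isConj hc₀')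
  -- `c₀' = a c₀ a⁻¹`
  have hPker : P ∈ (μ : W.geomPoints →+ W.geomPoints).ker := AddMonoidHom.mem_ker.mpr hP
  have haP : a⁻¹ • P ∈ (μ : W.geomPoints →+ W.geomPoints).ker :=
    smul_mem_ker_of_mem_ker W p hs hcomm hanti a⁻¹ hPker
  rw [← ha, mul_smul, mul_smul, hη _ (AddMonoidHom.mem_ker.mp haP), smul_comm a η, smul_inv_smul]

variable {K : Type} [Field K] [NumberField K]

omit hp in
/-- **INVISIBLE CLASSES LIE IN `A ℓ` FOR EVERY KOLYVAGIN PRIME.** `W/ℚ` elliptic with an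
endomorphism `μ` of `W(ℚ̄)` obeying the sign rule of `√−p` (`μ(gP) = ±g μ(P)` as `g√−p = ±√−p`;
on the Borel CM class: `exists_sqrt_end_of_cmRamified`); `K` imaginary quadratic with complex
conjugation `c`; `x ∈ H¹(K, W[n])` (`n = m` a natural level, e.g. `p^M`) a `c_*`-eigenclass of sign
`ν = ±1` whose values `[x, g]`, `g ∈ Γ_{K(W[n])}`, all lie on the line `ker μ` (`𝓞`-depth one), and
suppose SOME complex conjugation acts on `ker μ` by `−ν` (`η_line = −ν`). Then for EVERY prime `ℓ`
with `ℓ ∤ d_K`, `Frob(ℓ) = Frob(∞)` on `K(W[n])`, at whose place `w` the curve has good reduction,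
`w ∤ n`, and `x` is unramified at the primes of `\bar ℤ_K` above `w`: **`x_w = 0` in
`H¹(K_w, W[n])`** — `x` lies in the strict local kernel `A ℓ` of Kolyvagin's descent at every
Kolyvagin prime, so no Čebotarev axiom can prescribe it a non-zero local order.
[cite: McCallumLMS1991, §3 (3)] [cite: GrossLMS1991, Prop. 9.6] -/
theorem mem_torsionLocalKer_place_of_line_of_lineSign (hK : IsImaginaryQuadratic K)
    {c : K ≃ₐ[ℚ] K} (hc : c ≠ 1) {s : AlgebraicClosure ℚ} {μ : AddMonoid.End W.geomPoints}
    (hs : s ^ 2 = ((-(p : ℤ) : ℤ) : AlgebraicClosure ℚ))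
    (hcomm : ∀ g : absoluteGaloisGroup ℚ, g • s = s → ∀ P, μ (g • P) = g • μ P)
    (hanti : ∀ g : absoluteGaloisGroup ℚ, g • s = -s → ∀ P, μ (g • P) = -(g • μ P))
    {m : ℕ} (hm0 : m ≠ 0) {x : galH1Torsion (W.baseChange K) (m : ℤ)} {ν : ℤ}
    (hν : ν = 1 ∨ ν = -1) (hx : conjAct W c (m : ℤ) x = ν • x)
    (hline : ∀ g ∈ torsionFixing (W.baseChange K) (m : ℤ),
      μ ((RatClosure.torsionEquiv (K := K) W (m : ℤ)).symm (h1Eval (W.baseChange K) (m : ℤ) x g) :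
        W.geomTorsion (m : ℤ)) = 0)
    {c₁ : absoluteGaloisGroup ℚ} (hc₁ : IsComplexConjugation (Rat.castHom ℝ) c₁)
    (hη : ∀ P : W.geomPoints, μ P = 0 → c₁ • P = -(ν • P))
    {ℓ : ℕ} (hℓ : ℓ.Prime) (hℓD : ¬ ((ℓ : ℤ) ∣ NumberField.discr K))
    (hfrob : FrobEqFrobInfty W K m ℓ) {w : HeightOneSpectrum (𝓞 K)} (hw : (ℓ : 𝓞 K) ∈ w.asIdeal)
    (hgood : w ∉ (W.baseChange K).badPlaces (𝓞 K)) (hwm : ((m : ℤ) : 𝓞 K) ∉ w.asIdeal)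
    (hxunr : ∀ 𝔓 ∈ w.primesAbove, x ∈ unramifiedKer (geomTorsion (W.baseChange K) (m : ℤ)) 𝔓) :
    x ∈ (W.baseChange K).torsionLocalKer (w.adicCompletion K) (m : ℤ) := by
  have hn : (m : ℤ) ≠ 0 := by exact_mod_cast hm0
  obtain ⟨c₀, hc₀, ht, 𝔐, h𝔐, F, δ, g, hF, hgT, hFg, -⟩ :=
    exists_frobenius_conjGalCMH_mul_of_frobEqFrobInfty W hK hc hℓ hℓD hfrob hw
  have hinv : ∀ y, (absGaloisTransport (K := ℚ) (L := K) c₀).toRingEquiv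
      ((absGaloisTransport (K := ℚ) (L := K) c₀).toRingEquiv y) = y := fun y ↦
    RatClosure.absGaloisTransport_absGaloisTransport_of_sq_eq_one hc₀.sq_eq_one y
  haveI : CharZero (w.adicCompletion K) :=
    charZero_of_injective_algebraMap (algebraMap K (w.adicCompletion K)).injective
  -- the sign of `c₀` on the line is `-ν` as well
  have hη₀ : ∀ P : W.geomPoints, μ P = 0 → c₀ • P = (-ν) • P :=
    lineSign_of_isComplexConjugation_of_lineSign W p hc₁ hc₀ hs hcomm hanti (η := -ν)
      (fun P hP ↦ by rw [hη P hP, neg_smul])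
  have h𝔓w : w.primeBelow (closureEmb (K := K) (w.adicCompletion K)) 𝔐 ∈ w.primesAbove :=
    w.primeBelow_mem_primesAbove h𝔐
  refine mem_torsionLocalKer_of_antiEigen W ht hinv hn hν hx (fun g' hg' ↦ ?_) h𝔐 hF hgT hFg
    (inertia_le_torsionFixing (W.baseChange K) hgood hwm _ h𝔐)
    (torsionPointsMap_bijective (W.baseChange K) (w.adicCompletion K) hm0).2 (hxunr _ h𝔓w)
  rw [torsionMap_eq_lineSign_smul W ht (fun _ ↦ rfl) hη₀ (m : ℤ) _ (hline g' hg'), neg_smul]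

end Invisible

end Summit.BirchSwinnertonDyer.BirchSwinnertonDyer.Theorems.PrintCFram.BorelKolyvaginPairing

end
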